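import Literature.AlgebraicGeometry.ShimuraVarieties.UnitaryShimuraCurveSpecialPointComponentsTower
import Literature.AlgebraicGeometry.AbelianSchemes.RingActionOfPointwiseIdentities
import Literature.AlgebraicGeometry.Motives.GaloisThickening
import HarnessLib

/-!
# Rigidity over the thickened unitary Shimura curve: an identity of homomorphisms of abelian schemes over
# `X = (M_K) ⊗_L Fᵢ` which holds on the fibres over the SPECIAL complex points holds
# ([MumfordFogartyKirwan1994] Ch. 6 §1 Cor. 6.2 ∕ 6.4; [Deligne1979ShimuraVarieties] 2.1.2–2.1.3; [Kottwitz1992] §5 p. 390)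

Topic `AlgebraicGeometry/ShimuraVarieties`; namespace `Literature.AlgebraicGeometry.ShimuraVarieties.UnitaryCanonicalModel.RecordSystemGS`
(§1 is a dot-notation extension of ★ `AbelianSchemeOver.RingAction`, declared with its absolute name).  THEOREMS ONLY (no definition, no
named fact, no instance, no notation, no `sorry`).  Cell `hodgecm-mathlib` (D-0151), FLOOR 0, P6 «MOD» (crux hLiu418 = stmt-HodgeConjecture-24832,
`--supports`), organ **(R-RIG)** of the (γ′) road «SERRE TENSOR OVER `X`, CLASSIFIED» for the E-sheet socket `stub_SHEET` ∕ `hole_SHEET_complex` of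
`Cruxes/HLiu418/Lines/F0_P6a_StubESHEET.lean` (E-pen A-p01 (g28) 2026-09-02 08:39:31Z, glue LA7-p01 (g3)): the global intertwining `hact` of the
`𝒪_F`-actions along the comparison homomorphism is obtained from its truth at ONE CM point per connected component (organ (R-CM)) by rigidity.
HC_CM is proved only modulo the printed citations (2 remaining named inputs hLiu418 24832, h413 24833) until rung 0 closes; this file is generic
in the two abelian schemes and changes no count.

THE MATHEMATICS.  Let `S : RecordSystemGS L J⋆ τ K₀` be a record system of canonical models of the unitary Shimura curve, `K` a small level,
`Fᵢ ⊇ L` with a complex place `τE ∣ τ`, and `X := (M_K) ⊗_L Fᵢ` (a smooth curve over `Fᵢ`, hence locally Noetherian).  By ★ (G1)∕H0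
`exists_specialPoint_pt_mem_connectedComponent_tower` every connected component of `X_ℂ := X ⊗_{Fᵢ,τE} ℂ` contains an honest complex point
lying over a special point `[τw, aK]` of `M_K`; since `X_ℂ → X` is surjective (base change of `Spec ℂ → Spec Fᵢ`) and continuous images of
connected sets are connected, every connected component of `X` receives such a point (§2).  By rigidity of homomorphisms of abelian schemes
([MumfordFogartyKirwan1994] Ch. 6 §1 Cor. 6.2∕6.4, ★ B-α `eq_of_forall_exists_fieldPoint`) two homomorphisms `f, g : A → B` of abelian schemes
over `X` which agree after base change to those complex points agree (§3); in particular two `𝒪`-actions on `A`, `B` are intertwined by a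
homomorphism `e : A → B` as soon as they are intertwined on the special complex fibres (§1 generic, §3 over `X`) — the pointwise-to-global step
of every PEL comparison ([Kottwitz1992] §5 p. 390; [RapoportSmithlingZhang2020Diagonal] §4.1).

* §1 `AbelianSchemeOver.RingAction.forall_comp_eq_comp_of_forall_exists_fieldPoint` — generic: intertwining from one field point per component.
* §2 `exists_specialPoint_base_mem_connectedComponent` — every connected component of `X` receives a special complex point (H0 pushed down).
* §3 **`hom_eq_of_forall_specialPoint`**, **`forall_comp_eq_comp_of_forall_specialPoint`** — THE HEADS over `X` (honest-point currency of ★ H0).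
* §4 `left_comp_fst_eq_thickeningLift_left`, **`hom_eq_of_forall_specialPoint_sheet`**, **`forall_comp_eq_comp_of_forall_specialPoint_sheet`** — the same
  heads in SHEET currency: the test points are `ℓ_{τE}(z₀)`, `z₀ = (S.pts K)⁻¹ [τw, aK]` (the currency of the E-sheet socket, ★ `Motives.thickeningLift`).

## References
* [MumfordFogartyKirwan1994] D. Mumford, J. Fogarty, F. Kirwan, *Geometric Invariant Theory*, 3rd ed. (1994), Ch. 6 §1 Cor. 6.2 (p. 116), Cor. 6.4 (p. 117).
* [Deligne1979ShimuraVarieties] P. Deligne, *Variétés de Shimura* (1979), 2.1.2–2.1.3.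
* [Kottwitz1992] R. Kottwitz, *Points on some Shimura varieties over finite fields*, JAMS 5 (1992), §5 (p. 390).
* [RapoportSmithlingZhang2020Diagonal] M. Rapoport, B. Smithling, W. Zhang, Compositio 156 (2020), §4.1 (p. 17).
* [GortzWedhorn2020] U. Görtz, T. Wedhorn, *Algebraic Geometry I*, 2nd ed. (2020), §(4.8)–(4.9) (points of a base change as pairs).
-/

set_option autoImplicit false

noncomputable section

universe u

open Matrix NumberField CategoryTheory CategoryTheory.Limits AlgebraicGeometry Topology
open scoped MonObj
open Literature.NumberTheory.Automorphic.Liu2021.AppendixC (C5.OpenCompactSubgroup C5.SmallLevel)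
open Literature.NumberTheory.Automorphic.UnitaryGroup (finAdelic)
open Literature.AlgebraicGeometry.Motives (ComplexPoints AlgPoints SchemeOver baseChange)
open Literature.AlgebraicGeometry.Motives.AbelianVariety (bcSpec)
open Literature.AlgebraicGeometry.AbelianSchemes (AbelianSchemeOver)

namespace Literature.AlgebraicGeometry.ShimuraVarieties.UnitaryCanonicalModel

/-! ### §1 Generic: two ring actions are intertwined by a homomorphism as soon as they are at one field point per connected component -/

/-- **Intertwining from one field point per connected component** (dot-notation extension of ★ `AbelianSchemeOver.RingAction`, declared here with
its absolute name): over a locally Noetherian base `S`, let `actA`, `actB` be `𝒪`-actions on abelian schemes `A`, `B` and `e : A → B` a homomorphism.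
If every `x ∈ S` has a field-valued point `s` centred in its connected component with `(ι_A(b) ≫ e) ×_S s = (e ≫ ι_B(b)) ×_S s` for all `b ∈ 𝒪`, then
`ι_A(b) ≫ e = e ≫ ι_B(b)` for all `b` — ★ B-α `forall_eq_of_forall_exists_fieldPoint` for the family of pairs indexed by `𝒪`.
[cite: MumfordFogartyKirwan1994, Ch. 6 §1 Corollary 6.2 (p. 116) and Corollary 6.4 (p. 117)] [cite: Kottwitz1992, §5 (p. 390)] -/
theorem _root_.Literature.AlgebraicGeometry.AbelianSchemes.AbelianSchemeOver.RingAction.forall_comp_eq_comp_of_forall_exists_fieldPoint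
    {S : Scheme.{u}} [IsLocallyNoetherian S] {A B : AbelianSchemeOver S} {O : Type*} [CommRing O]
    (actA : A.RingAction O) (actB : B.RingAction O) (e : A.X ⟶ B.X) [IsMonHom e]
    (h : ∀ x : S, ∃ (K : Type u) (_ : Field K) (s : Spec (.of K) ⟶ S),
      s.base (IsLocalRing.closedPoint K) ∈ connectedComponent x ∧
        ∀ b : O, (Over.pullback s).map (actA.i b ≫ e) = (Over.pullback s).map (e ≫ actB.i b)) :
    ∀ b : O, actA.i b ≫ e = e ≫ actB.i b := by
  haveI : ∀ b : O, IsMonHom (actA.i b ≫ e) := fun b => by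
    haveI := actA.isMonHom b
    infer_instance
  haveI : ∀ b : O, IsMonHom (e ≫ actB.i b) := fun b => by
    haveI := actB.isMonHom b
    infer_instance
  exact AbelianSchemeOver.forall_eq_of_forall_exists_fieldPoint (fun b => actA.i b ≫ e) (fun b => e ≫ actB.i b) h

variable {L : Type} [Field L] [NumberField L] [IsCMField L] {Jstar : Matrix (Fin 2) (Fin 2) L} {τ : L →+* ℂ}
  {K₀ : C5.OpenCompactSubgroup ↥(finAdelic (↥(maximalRealSubfield L)) L (IsCMField.complexConj L) 2 Jstar)}

namespace RecordSystemGS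

/-! ### §2 Every connected component of `X = (M_K) ⊗_L Fᵢ` receives a special complex point -/

set_option maxHeartbeats 400000 in
/-- **Every connected component of `X := (M_K) ⊗_L Fᵢ` receives a special complex point**: for every `x ∈ X` there are `w ∈ L²` with `τw` in the
negative cone, an adelic `a`, and an honest complex point `P` of `X_ℂ := X ⊗_{Fᵢ,τE} ℂ` whose image in `X` lies in the connected component of `x` and
which lies FLAT over the special point `[τw, aK]` of `M_K` (`P ≫ pr ≫ pr = ((S.pts K)⁻¹ [τw, aK]).left`) — ★ H0 `exists_specialPoint_pt_mem_connectedComponent_tower`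
at a lift of `x` to `X_ℂ` (the projection `X_ℂ → X` is surjective, a base change of `Spec ℂ → Spec Fᵢ`), pushed down along the continuous projection.
[cite: Deligne1979ShimuraVarieties, 2.1.2–2.1.3] [cite: Milne2005ShimuraVarieties, §13 Lemma 13.5 p. 118] -/
theorem exists_specialPoint_base_mem_connectedComponent (S : RecordSystemGS L Jstar τ K₀) (K : C5.SmallLevel K₀)
    {Fi : Type} [Field Fi] [Algebra L Fi] (τE : Fi →+* ℂ) (hτE : τE.comp (algebraMap L Fi) = τ)
    (x : ↥((baseChange L Fi).obj (S.M.obj K)).left) :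
    letI : Algebra Fi ℂ := τE.toAlgebra
    letI : Algebra L ℂ := τ.toAlgebra
    ∃ (w : Fin 2 → L) (hw : (fun i => τ (w i)) ∈ negCone (Jstar.map τ))
      (a : ↥(finAdelic (↥(maximalRealSubfield L)) L (IsCMField.complexConj L) 2 Jstar))
      (P : ComplexPoints ((baseChange Fi ℂ).obj ((baseChange L Fi).obj (S.M.obj K)))),
      (P.left ≫ pullback.fst ((baseChange L Fi).obj (S.M.obj K)).hom (bcSpec Fi ℂ)).base (IsLocalRing.closedPoint ℂ) ∈
          connectedComponent x ∧
      P.left ≫ pullback.fst ((baseChange L Fi).obj (S.M.obj K)).hom (bcSpec Fi ℂ) ≫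
          pullback.fst (S.M.obj K).hom (bcSpec L Fi) =
        ((S.pts K).symm (ShimuraSetGS.mk L Jstar τ K.1.1 (fun i => τ (w i)) hw a)).left := by
  letI : Algebra Fi ℂ := τE.toAlgebra
  letI : Algebra L ℂ := τ.toAlgebra
  -- the projection `pr : X_ℂ → X` is surjective (base change of `Spec ℂ → Spec Fᵢ`, a map onto a point)
  haveI : Surjective (bcSpec Fi ℂ) := ⟨fun _ => ⟨Classical.arbitrary _, Subsingleton.elim _ _⟩⟩
  obtain ⟨x', hx'⟩ := (pullback.fst ((baseChange L Fi).obj (S.M.obj K)).hom (bcSpec Fi ℂ)).surjective x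
  -- ★ H0 at the lift `x'`
  obtain ⟨w, hw, a, P, -, hP, hflat⟩ := S.exists_specialPoint_pt_mem_connectedComponent_tower K τE hτE x'
  refine ⟨w, hw, a, P, ?_, hflat⟩
  -- push the component membership down along the continuous projection
  rw [Scheme.Hom.comp_apply]
  have hpre : _root_.IsPreconnected
      ((pullback.fst ((baseChange L Fi).obj (S.M.obj K)).hom (bcSpec Fi ℂ)).base '' connectedComponent x') :=
    isPreconnected_connectedComponent.image _
      (pullback.fst ((baseChange L Fi).obj (S.M.obj K)).hom (bcSpec Fi ℂ)).base.hom.continuous.continuousOn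
  have hsub := hpre.subset_connectedComponent (x := x) ⟨x', mem_connectedComponent, hx'⟩
  exact hsub ⟨_, hP, rfl⟩

/-! ### §3 The heads: rigidity over `X` from the special complex fibres -/

set_option maxHeartbeats 400000 in
/-- **Two homomorphisms of abelian schemes over `X := (M_K) ⊗_L Fᵢ` which agree on the fibres over the special complex points agree.**
For abelian schemes `A`, `B` over `X` and homomorphisms `f, g : A → B`: if `f ×_X P = g ×_X P` for every honest complex point `P` of
`X_ℂ = X ⊗_{Fᵢ,τE} ℂ` lying flat over a special point `[τw, aK]` of `M_K` (read as the `X`-point `P ≫ pr`), then `f = g` — §2 + ★ B-α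
`eq_of_forall_exists_fieldPoint` (`X` is smooth over `Fᵢ`, hence locally Noetherian).
[cite: MumfordFogartyKirwan1994, Ch. 6 §1 Corollary 6.2 (p. 116) and Corollary 6.4 (p. 117)] [cite: Deligne1979ShimuraVarieties, 2.1.2–2.1.3] -/
theorem hom_eq_of_forall_specialPoint (S : RecordSystemGS L Jstar τ K₀) (K : C5.SmallLevel K₀)
    {Fi : Type} [Field Fi] [Algebra L Fi] (τE : Fi →+* ℂ) (hτE : τE.comp (algebraMap L Fi) = τ)
    {A B : AbelianSchemeOver ((baseChange L Fi).obj (S.M.obj K)).left} (f g : A.X ⟶ B.X) [IsMonHom f] [IsMonHom g]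
    (h : letI : Algebra Fi ℂ := τE.toAlgebra
      letI : Algebra L ℂ := τ.toAlgebra
      ∀ (w : Fin 2 → L) (hw : (fun i => τ (w i)) ∈ negCone (Jstar.map τ))
        (a : ↥(finAdelic (↥(maximalRealSubfield L)) L (IsCMField.complexConj L) 2 Jstar))
        (P : ComplexPoints ((baseChange Fi ℂ).obj ((baseChange L Fi).obj (S.M.obj K)))),
        P.left ≫ pullback.fst ((baseChange L Fi).obj (S.M.obj K)).hom (bcSpec Fi ℂ) ≫
            pullback.fst (S.M.obj K).hom (bcSpec L Fi) =
          ((S.pts K).symm (ShimuraSetGS.mk L Jstar τ K.1.1 (fun i => τ (w i)) hw a)).left →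
        (Over.pullback (P.left ≫ pullback.fst ((baseChange L Fi).obj (S.M.obj K)).hom (bcSpec Fi ℂ))).map f =
          (Over.pullback (P.left ≫ pullback.fst ((baseChange L Fi).obj (S.M.obj K)).hom (bcSpec Fi ℂ))).map g) :
    f = g := by
  letI : Algebra Fi ℂ := τE.toAlgebra
  letI : Algebra L ℂ := τ.toAlgebra
  -- `X` is locally Noetherian: smooth over the field `Fᵢ`
  haveI := S.smooth K
  haveI : Smooth (S.M.obj K).hom := SmoothOfRelativeDimension.smooth 1 _
  haveI : Smooth ((baseChange L Fi).obj (S.M.obj K)).hom := by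
    change Smooth (pullback.snd (S.M.obj K).hom _)
    infer_instance
  haveI : IsLocallyNoetherian ((baseChange L Fi).obj (S.M.obj K)).left :=
    LocallyOfFiniteType.isLocallyNoetherian ((baseChange L Fi).obj (S.M.obj K)).hom
  refine AbelianSchemeOver.eq_of_forall_exists_fieldPoint f g fun x => ?_
  obtain ⟨w, hw, a, P, hP, hflat⟩ := S.exists_specialPoint_base_mem_connectedComponent K τE hτE x
  exact ⟨ℂ, inferInstance, P.left ≫ pullback.fst ((baseChange L Fi).obj (S.M.obj K)).hom (bcSpec Fi ℂ), hP, h w hw a P hflat⟩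

/-- **(R-RIG) — two `𝒪`-actions on abelian schemes over `X := (M_K) ⊗_L Fᵢ` are intertwined by a homomorphism `e` as soon as they are on the
fibres over the special complex points**: if `(ι_A(b) ≫ e) ×_X P = (e ≫ ι_B(b)) ×_X P` for all `b ∈ 𝒪` at every honest complex point `P` of `X_ℂ`
lying flat over a special point `[τw, aK]` of `M_K`, then `ι_A(b) ≫ e = e ≫ ι_B(b)` for all `b` — the pointwise-to-global step of the (γ′) road for the
E-sheet law (the fibre identities at the CM points are organ (R-CM); `𝒪 = 𝓞 F`, `A` the Serre tensor family, `B` the conjugate-sheet pull-back).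
[cite: MumfordFogartyKirwan1994, Ch. 6 §1 Corollary 6.2 (p. 116) and Corollary 6.4 (p. 117)] [cite: Kottwitz1992, §5 (p. 390)] [cite: RapoportSmithlingZhang2020Diagonal, §4.1 (p. 17)] -/
theorem forall_comp_eq_comp_of_forall_specialPoint (S : RecordSystemGS L Jstar τ K₀) (K : C5.SmallLevel K₀)
    {Fi : Type} [Field Fi] [Algebra L Fi] (τE : Fi →+* ℂ) (hτE : τE.comp (algebraMap L Fi) = τ)
    {A B : AbelianSchemeOver ((baseChange L Fi).obj (S.M.obj K)).left} {O : Type*} [CommRing O]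
    (actA : A.RingAction O) (actB : B.RingAction O) (e : A.X ⟶ B.X) [IsMonHom e]
    (h : letI : Algebra Fi ℂ := τE.toAlgebra
      letI : Algebra L ℂ := τ.toAlgebra
      ∀ (w : Fin 2 → L) (hw : (fun i => τ (w i)) ∈ negCone (Jstar.map τ))
        (a : ↥(finAdelic (↥(maximalRealSubfield L)) L (IsCMField.complexConj L) 2 Jstar))
        (P : ComplexPoints ((baseChange Fi ℂ).obj ((baseChange L Fi).obj (S.M.obj K)))),
        P.left ≫ pullback.fst ((baseChange L Fi).obj (S.M.obj K)).hom (bcSpec Fi ℂ) ≫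
            pullback.fst (S.M.obj K).hom (bcSpec L Fi) =
          ((S.pts K).symm (ShimuraSetGS.mk L Jstar τ K.1.1 (fun i => τ (w i)) hw a)).left →
        ∀ b : O, (Over.pullback (P.left ≫ pullback.fst ((baseChange L Fi).obj (S.M.obj K)).hom (bcSpec Fi ℂ))).map (actA.i b ≫ e) =
          (Over.pullback (P.left ≫ pullback.fst ((baseChange L Fi).obj (S.M.obj K)).hom (bcSpec Fi ℂ))).map (e ≫ actB.i b)) :
    ∀ b : O, actA.i b ≫ e = e ≫ actB.i b := by
  intro b
  haveI := actA.isMonHom b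
  haveI := actB.isMonHom b
  exact S.hom_eq_of_forall_specialPoint K τE hτE (actA.i b ≫ e) (e ≫ actB.i b) fun w hw a P hflat => h w hw a P hflat b


/-! ### §4 The heads in SHEET currency: the special `X`-points as `ℓ_{τE}(z₀)`, `z₀ = (S.pts K)⁻¹ [τw, aK]` -/

/-- An honest complex point `P` of `X_ℂ = X ⊗_{Fᵢ,τE} ℂ` lying flat over the `Ω`-point `z` of `M_K` IS the sheet point `ℓ_{eE}(z)` of
`X = (M_K) ⊗_L Fᵢ` for the sheet `eE = τE` (as an `L`-algebra map `Fᵢ → ℂ`): `P ≫ pr = ℓ_{eE}(z)` — both coordinates agree (`pr₁`: flatness;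
`pr₂`: `P` is a section over `Spec ℂ`, so `P ≫ pr ≫ (X → Spec Fᵢ) = Spec τE = Spec eE`). [cite: GortzWedhorn2020, §(4.8)–(4.9)] -/
theorem left_comp_fst_eq_thickeningLift_left (S : RecordSystemGS L Jstar τ K₀) (K : C5.SmallLevel K₀)
    {Fi : Type} [Field Fi] [Algebra L Fi] (τE : Fi →+* ℂ)
    (eE : letI : Algebra L ℂ := τ.toAlgebra; Fi →ₐ[L] ℂ) (heE : ∀ x, eE x = τE x)
    (P : letI : Algebra Fi ℂ := τE.toAlgebra; ComplexPoints ((baseChange Fi ℂ).obj ((baseChange L Fi).obj (S.M.obj K))))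
    (z : letI : Algebra L ℂ := τ.toAlgebra; AlgPoints (S.M.obj K) ℂ)
    (hflat : letI : Algebra Fi ℂ := τE.toAlgebra
      P.left ≫ pullback.fst ((baseChange L Fi).obj (S.M.obj K)).hom (bcSpec Fi ℂ) ≫
        pullback.fst (S.M.obj K).hom (bcSpec L Fi) = z.left) :
    letI : Algebra Fi ℂ := τE.toAlgebra
    letI : Algebra L ℂ := τ.toAlgebra
    P.left ≫ pullback.fst ((baseChange L Fi).obj (S.M.obj K)).hom (bcSpec Fi ℂ) =
      (Motives.thickeningLift eE (S.M.obj K) z).left := by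
  letI : Algebra Fi ℂ := τE.toAlgebra
  letI : Algebra L ℂ := τ.toAlgebra
  rw [Motives.thickeningLift_left]
  apply pullback.hom_ext
  · -- first coordinate: flatness
    exact (Category.assoc _ _ _).trans (hflat.trans (pullback.lift_fst _ _ _).symm)
  · -- second coordinate: `P` is a section over `Spec ℂ`, so `P ≫ pr ≫ (X → Spec Fᵢ) = Spec τE = Spec eE`
    have hP : P.left ≫ pullback.snd ((baseChange L Fi).obj (S.M.obj K)).hom (bcSpec Fi ℂ) = 𝟙 _ := by
      refine (Over.w P).trans ?_
      change Spec.map (CommRingCat.ofHom (algebraMap ℂ ℂ)) = _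
      rw [Algebra.algebraMap_self, CommRingCat.ofHom_id]
      exact Spec.map_id _
    have he : Spec.map (CommRingCat.ofHom (eE : Fi →+* ℂ)) = bcSpec Fi ℂ := by
      have h : (eE : Fi →+* ℂ) = algebraMap Fi ℂ := RingHom.ext fun x => heE x
      rw [h]
    refine (Category.assoc _ _ _).trans ?_
    refine (congrArg (P.left ≫ ·)
      (pullback.condition (f := ((baseChange L Fi).obj (S.M.obj K)).hom) (g := bcSpec Fi ℂ))).trans ?_
    refine (Category.assoc _ _ _).symm.trans ?_
    refine (congrArg (· ≫ bcSpec Fi ℂ) hP).trans ?_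
    refine (Category.id_comp _).trans ?_
    exact he.symm.trans (pullback.lift_snd _ _ _).symm

set_option maxHeartbeats 400000 in
/-- **Two homomorphisms of abelian schemes over `X := (M_K) ⊗_L Fᵢ` which agree on the fibres over the sheet points `ℓ_{τE}(z₀)` of the
special points `z₀ = (S.pts K)⁻¹ [τw, aK]` of `M_K` agree** — §3 `hom_eq_of_forall_specialPoint` with the special `X`-points rewritten as sheet
points (`left_comp_fst_eq_thickeningLift_left`); `eE` is the chart sheet `τE` as an `L`-algebra map.
[cite: MumfordFogartyKirwan1994, Ch. 6 §1 Corollary 6.2 (p. 116) and Corollary 6.4 (p. 117)] [cite: Deligne1979ShimuraVarieties, 2.1.2–2.1.3] -/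
theorem hom_eq_of_forall_specialPoint_sheet (S : RecordSystemGS L Jstar τ K₀) (K : C5.SmallLevel K₀)
    {Fi : Type} [Field Fi] [Algebra L Fi] (τE : Fi →+* ℂ) (hτE : τE.comp (algebraMap L Fi) = τ)
    (eE : letI : Algebra L ℂ := τ.toAlgebra; Fi →ₐ[L] ℂ) (heE : ∀ x, eE x = τE x)
    {A B : AbelianSchemeOver ((baseChange L Fi).obj (S.M.obj K)).left} (f g : A.X ⟶ B.X) [IsMonHom f] [IsMonHom g]
    (h : letI : Algebra L ℂ := τ.toAlgebra
      ∀ (w : Fin 2 → L) (hw : (fun i => τ (w i)) ∈ negCone (Jstar.map τ))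
        (a : ↥(finAdelic (↥(maximalRealSubfield L)) L (IsCMField.complexConj L) 2 Jstar)),
        (Over.pullback (Motives.thickeningLift eE (S.M.obj K)
            ((S.pts K).symm (ShimuraSetGS.mk L Jstar τ K.1.1 (fun i => τ (w i)) hw a))).left).map f =
          (Over.pullback (Motives.thickeningLift eE (S.M.obj K)
            ((S.pts K).symm (ShimuraSetGS.mk L Jstar τ K.1.1 (fun i => τ (w i)) hw a))).left).map g) :
    f = g := by
  letI : Algebra Fi ℂ := τE.toAlgebra
  letI : Algebra L ℂ := τ.toAlgebra
  refine S.hom_eq_of_forall_specialPoint K τE hτE f g fun w hw a P hflat => ?_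
  rw [S.left_comp_fst_eq_thickeningLift_left K τE eE heE P _ hflat]
  exact h w hw a

/-- **(R-RIG), SHEET CURRENCY — two `𝒪`-actions on abelian schemes over `X := (M_K) ⊗_L Fᵢ` are intertwined by a homomorphism `e` as soon as
they are on the fibres over the sheet points `ℓ_{τE}(z₀)` of the special points `z₀ = (S.pts K)⁻¹ [τw, aK]`** (the (R-CM) fibre identities in the
currency of the E-sheet socket `hole_SHEET_complex`, whose complex points are `ℓ_{τE}(z)`). [cite: MumfordFogartyKirwan1994, Ch. 6 §1 Corollary 6.2 (p. 116) and Corollary 6.4 (p. 117)] [cite: Kottwitz1992, §5 (p. 390)] -/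
theorem forall_comp_eq_comp_of_forall_specialPoint_sheet (S : RecordSystemGS L Jstar τ K₀) (K : C5.SmallLevel K₀)
    {Fi : Type} [Field Fi] [Algebra L Fi] (τE : Fi →+* ℂ) (hτE : τE.comp (algebraMap L Fi) = τ)
    (eE : letI : Algebra L ℂ := τ.toAlgebra; Fi →ₐ[L] ℂ) (heE : ∀ x, eE x = τE x)
    {A B : AbelianSchemeOver ((baseChange L Fi).obj (S.M.obj K)).left} {O : Type*} [CommRing O]
    (actA : A.RingAction O) (actB : B.RingAction O) (e : A.X ⟶ B.X) [IsMonHom e]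
    (h : letI : Algebra L ℂ := τ.toAlgebra
      ∀ (w : Fin 2 → L) (hw : (fun i => τ (w i)) ∈ negCone (Jstar.map τ))
        (a : ↥(finAdelic (↥(maximalRealSubfield L)) L (IsCMField.complexConj L) 2 Jstar)) (b : O),
        (Over.pullback (Motives.thickeningLift eE (S.M.obj K)
            ((S.pts K).symm (ShimuraSetGS.mk L Jstar τ K.1.1 (fun i => τ (w i)) hw a))).left).map (actA.i b ≫ e) =
          (Over.pullback (Motives.thickeningLift eE (S.M.obj K)
            ((S.pts K).symm (ShimuraSetGS.mk L Jstar τ K.1.1 (fun i => τ (w i)) hw a))).left).map (e ≫ actB.i b)) :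
    ∀ b : O, actA.i b ≫ e = e ≫ actB.i b := by
  intro b
  haveI := actA.isMonHom b
  haveI := actB.isMonHom b
  exact S.hom_eq_of_forall_specialPoint_sheet K τE hτE eE heE (actA.i b ≫ e) (e ≫ actB.i b) fun w hw a => h w hw a b

end RecordSystemGS

end Literature.AlgebraicGeometry.ShimuraVarieties.UnitaryCanonicalModel

end
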